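import Summits.NavierStokesRegularity.NavierStokesRegularity.Theorems.TypeICertificateLadderTargetFiveHalvesWindowDepletedSlice
import Summits.NavierStokesRegularity.NavierStokesRegularity.Theorems.TypeICertificateLadderRungReynoldsOneWeightedSlab

/-!
# Crux `Target` (stmt-NavierStokesRegularity-1217), line `depletion-ladder` at `q = 5/2`: the
# DEPLETED weighted `L^{5/2}` vorticity SLAB inequality (law with explicit gradient bound)

`--supports stmt-NavierStokesRegularity-1217` (file 2′ of the depleted `q = 5/2` chain; SUPERSEDES
`depletedSlab` of `…DepletedSlab.lean`, whose law schema omits the gradient bound `‖Dv‖ ≤ B` and is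
therefore not satisfiable at `κ = 1` — a spike train of vorticity with `∫(|ω|²+1)^{1/4}Σ|∂ᵢω|² = ∞`
but `Dv, D²v ∈ L²` makes its right-hand side a junk integral; here every integral in the law is
finite under the law's own premises, and `κ = 1` is a theorem, `FiveHalvesWindow.law_one`). Rung one's
slab inequality `∫F(curl u(s)) ≤ exp((15/(16ν))∫₀ˢ‖u‖²_∞)∫F(curl u(0))` (`stub_weightedVorticitySlab`)
under the `q = 5/2` DEPLETION LAW with constant `κ` (hypothesis `hlaw`, the weighted Lamb pairing
`∫(|ω|²+1)^{1/4}⟪(ω·∇)ω, v⟫` of every admissible field bounded by `κ·‖v‖_∞·(∫wt|ω|²)^{1/2}(∫wtΣ|∂ᵢω|²)^{1/2}`)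
becomes `∫F(curl u(s)) ≤ exp((5c/(2ν))∫₀ˢ‖u‖²_∞)∫F(curl u(0))` for every `c ≥ (2κ²+1)/8` — the
Grönwall coefficient `5c/2 = 5(2κ²+1)/16` is the coefficient `q(κ_A² + (q−2)κ_B²)/4` of the depleted
`L^q` budget at `q = 5/2`, `κ_B = 1` (`TypeICertificateLadderTargetDepletedBudgetReach.lean`). The
proof is rung one's (`…RungReynoldsOneWeightedSlab.lean`) with the slice bound `depletedSlice_curl`.
[folklore: Grönwall bookkeeping]
-/

noncomputable section

open Set Filter Topology MeasureTheory
open scoped RealInnerProductSpace ENNReal NNReal Laplacian ContDiff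
open Literature.Analysis.FluidPDE

namespace Summit.NavierStokesRegularity.NavierStokesRegularity.Theorems.FiveHalvesWindow

-- the problem directory `NavierStokesRegularity/NavierStokesRegularity` forces the duplicated namespace
set_option linter.dupNamespace false

open Summit.NavierStokesRegularity.NavierStokesRegularity.Theorems.RungReynoldsOne
open Summit.NavierStokesRegularity.NavierStokesRegularity.Theorems.RungReynoldsOne.WeightedSlice

/-- **The DEPLETED weighted `L^{5/2}` vorticity slab inequality** (rung one's stub S3
`stub_weightedVorticitySlab` with the slice constant `3/8` replaced by any `c ≥ (2κ²+1)/8` under the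
`q = 5/2` DEPLETION LAW with constant `κ`). The law (hypothesis `hlaw`, stated inline): for every
`C³` divergence-free `v : ℝ³ → ℝ³` bounded by `M`, with bounded gradient `‖Dv‖ ≤ B` and `Dv, D²v ∈ L²`, the weighted Lamb pairing
obeys `|∫ wt⟪(ω·∇)ω, v⟫| ≤ κ·M·(∫wt|ω|²)^{1/2}(∫wt Σᵢ|∂ᵢω|²)^{1/2}`, `ω = curl v`,
`wt = (|ω|²+1)^{1/4}` (Cauchy–Schwarz: `κ = 1`). Conclusion: for a classical solution with
`u, ∂ₜu, p` in Tao's `L²`-Sobolev class on `[0,T] × ℝ³`, `0 < s ≤ T`, `∫₀ˢ‖u‖²_∞ < ∞`: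
`∫ F(curl u(s)) ≤ exp((5c/(2ν)) ∫₀ˢ ‖u(t)‖²_{L^∞} dt) ∫ F(curl u(0))`, `F(y) = (|y|²+1)^{5/4} − 1`
(`c = 3/8`: rung one's `15/(16ν)`). Proof: rung one's slab proof verbatim with the slice bound
`depletedSlice_curl` (law instance at `v = u(t)`, `M = ‖u(t)‖_∞`) and the weighted balance
(`stub_weightedVorticityBalance`, hypothesis `hS2`). [folklore: Grönwall bookkeeping] -/
theorem depletedSlab_law {κ c : ℝ} (hc : (2 * κ ^ 2 + 1) / 8 ≤ c)
    (hlaw : ∀ (v : EuclideanSpace ℝ (Fin 3) → EuclideanSpace ℝ (Fin 3)) (M B : ℝ),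
      ContDiff ℝ 3 v → VectorCalculus.IsDivFree v → (∀ x, ‖v x‖ ≤ M) →
      (∀ x, ‖fderiv ℝ v x‖ ≤ B) →
      (∫⁻ x, ‖iteratedFDeriv ℝ 1 v x‖ₑ ^ 2 < ⊤) → (∫⁻ x, ‖iteratedFDeriv ℝ 2 v x‖ₑ ^ 2 < ⊤) →
      |∫ x, (‖curl v x‖ ^ 2 + 1) ^ (1 / 4 : ℝ) * ⟪fderiv ℝ (curl v) x (curl v x), v x⟫| ≤
        κ * M * Real.sqrt (∫ x, (‖curl v x‖ ^ 2 + 1) ^ (1 / 4 : ℝ) * ‖curl v x‖ ^ 2) *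
          Real.sqrt (∫ x, (‖curl v x‖ ^ 2 + 1) ^ (1 / 4 : ℝ) *
            ∑ i, ‖fderiv ℝ (curl v) x (EuclideanSpace.basisFun (Fin 3) ℝ i)‖ ^ 2)) :
    (∀ ⦃T : ℝ⦄, 0 < T → ∀ ⦃w : ℝ → EuclideanSpace ℝ (Fin 3) → EuclideanSpace ℝ (Fin 3)⦄,
      IsSmoothSpaceTimeOn (Icc 0 T) w →
    ∀ ⦃C₀ C₁ : ℝ≥0⦄ ⦃B : ℝ⦄,
      (∀ t ∈ Icc 0 T, ∫⁻ x, ‖w t x‖ₑ ^ 2 ≤ C₀) →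
      (∀ t ∈ Icc 0 T, ∫⁻ x, ‖timeDerivWithin (Icc 0 T) w t x‖ₑ ^ 2 ≤ C₁) →
      (∀ t ∈ Icc 0 T, ∀ x, ‖w t x‖ ≤ B) →
      IntegrableOn (fun t => ∫ x, 5 / 2 * ((‖w t x‖ ^ 2 + 1) ^ (1 / 4 : ℝ) *
          ⟪w t x, timeDerivWithin (Icc 0 T) w t x⟫)) (Ioo 0 T) ∧
      ContinuousOn (fun t => ∫ x, ((‖w t x‖ ^ 2 + 1) ^ (5 / 4 : ℝ) - 1)) (Icc 0 T) ∧
      ∀ b ∈ Ioc 0 T, ∫ x, ((‖w b x‖ ^ 2 + 1) ^ (5 / 4 : ℝ) - 1) =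
        (∫ x, ((‖w 0 x‖ ^ 2 + 1) ^ (5 / 4 : ℝ) - 1)) +
          ∫ t in (0 : ℝ)..b, ∫ x, 5 / 2 * ((‖w t x‖ ^ 2 + 1) ^ (1 / 4 : ℝ) *
            ⟪w t x, timeDerivWithin (Icc 0 T) w t x⟫)) →
    ∀ ⦃ν T : ℝ⦄, 0 < ν → 0 < T →
    ∀ ⦃u : ℝ → EuclideanSpace ℝ (Fin 3) → EuclideanSpace ℝ (Fin 3)⦄
      ⦃p : ℝ → EuclideanSpace ℝ (Fin 3) → ℝ⦄,
      IsClassicalNSSolutionOn (Icc 0 T) ν 0 u p →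
      HasBoundedSobolevNormsOn (Icc 0 T) u →
      HasBoundedSobolevNormsOn (Icc 0 T) (timeDerivWithin (Icc 0 T) u) →
      (∀ n : ℕ, ∃ C : ℝ≥0, ∀ t ∈ Icc 0 T, ∫⁻ x, ‖iteratedFDeriv ℝ n (p t) x‖ₑ ^ 2 ≤ C) →
    ∀ ⦃s : ℝ⦄, s ∈ Ioc 0 T →
      (∫⁻ t in Ioo 0 s, ENNReal.ofReal ((eLpNorm (u t) ⊤ volume).toReal ^ (2 : ℝ)) ≠ ⊤) →
      ∫⁻ x, ENNReal.ofReal ((‖curl (u s) x‖ ^ 2 + 1) ^ (5 / 4 : ℝ) - 1) ≤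
        ENNReal.ofReal (Real.exp (5 * c / (2 * ν) *
            (∫⁻ t in Ioo 0 s, ENNReal.ofReal ((eLpNorm (u t) ⊤ volume).toReal ^ (2 : ℝ))).toReal)) *
          ∫⁻ x, ENNReal.ofReal ((‖curl (u 0) x‖ ^ 2 + 1) ^ (5 / 4 : ℝ) - 1) := by
  intro hS2 ν T hν hT u p hsol hu hut _hp s hs hA
  have hc0 : 0 ≤ c := le_trans (by positivity) hc
  have hU : UniqueDiffOn ℝ (Icc 0 T) := uniqueDiffOn_Icc hT
  set W : ℝ → EuclideanSpace ℝ (Fin 3) → EuclideanSpace ℝ (Fin 3) :=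
    timeDerivWithin (Icc 0 T) u with hW
  have hWsm : IsSmoothSpaceTimeOn (Icc 0 T) W := hsol.smooth_velocity.timeDerivWithin hU
  -- the vorticity family and its time derivative
  have hwsm : IsSmoothSpaceTimeOn (Icc 0 T) (vorticity u) :=
    hsol.smooth_velocity.isSmoothSpaceTimeOn_vorticity hU
  have hwt : ∀ t ∈ Icc 0 T, ∀ x, timeDerivWithin (Icc 0 T) (vorticity u) t x = curl (W t) x :=
    fun t ht x => (hsol.smooth_velocity.curl_timeDerivWithin_of_uniqueDiffOn hU ht x).symm
  -- uniform bounds on the slab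
  obtain ⟨B₀, hB₀0, hB₀⟩ := exists_forall_norm_le_of_hasBoundedSobolevNormsOn hsol hu
  obtain ⟨B₁, hB₁0, hB₁⟩ := exists_forall_norm_fderiv_le_of_hasBoundedSobolevNormsOn
    (fun t ht => (hsol.contDiff_velocity ht).of_le (by norm_cast)) hu
  obtain ⟨C₁, hC₁⟩ := hu 1
  obtain ⟨C₂, hC₂⟩ := hu 2
  obtain ⟨C₃, hC₃⟩ := hu 3
  obtain ⟨E₁, hE₁⟩ := hut 1
  -- curl bounds: `‖curl v x‖² ≤ 2|∇v|² ≤ 6‖Dv‖²`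
  have hcurl_enorm : ∀ (v : EuclideanSpace ℝ (Fin 3) → EuclideanSpace ℝ (Fin 3)) (x),
      ‖curl v x‖ₑ ^ 2 ≤ 6 * ‖iteratedFDeriv ℝ 1 v x‖ₑ ^ 2 := by
    intro v x
    have h1 : ‖curl v x‖ₑ ^ 2 ≤ ENNReal.ofReal (2 * frobeniusNormSq (fderiv ℝ v x)) := by
      rw [← ofReal_norm, ← ENNReal.ofReal_pow (norm_nonneg _)]
      exact ENNReal.ofReal_le_ofReal (norm_curl_sq_le_two_mul_frobeniusNormSq v x)
    refine h1.trans ?_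
    rw [ENNReal.ofReal_mul (by norm_num), ← ofReal_norm, norm_iteratedFDeriv_one, ofReal_norm,
      ENNReal.ofReal_ofNat]
    calc (2 : ℝ≥0∞) * ENNReal.ofReal (frobeniusNormSq (fderiv ℝ v x))
        ≤ 2 * (3 * ‖fderiv ℝ v x‖ₑ ^ 2) := by
          gcongr; exact ofReal_frobeniusNormSq_le_three_mul_enorm_sq _
      _ = 6 * ‖fderiv ℝ v x‖ₑ ^ 2 := by ring
  have hw0 : ∀ t ∈ Icc 0 T, ∫⁻ x, ‖vorticity u t x‖ₑ ^ 2 ≤ 6 * C₁ := by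
    intro t ht
    calc ∫⁻ x, ‖vorticity u t x‖ₑ ^ 2 ≤ ∫⁻ x, 6 * ‖iteratedFDeriv ℝ 1 (u t) x‖ₑ ^ 2 :=
          lintegral_mono fun x => hcurl_enorm (u t) x
      _ = 6 * ∫⁻ x, ‖iteratedFDeriv ℝ 1 (u t) x‖ₑ ^ 2 := lintegral_const_mul' _ _ (by norm_num)
      _ ≤ 6 * C₁ := by gcongr; exact hC₁ t ht
  have hw1 : ∀ t ∈ Icc 0 T,
      ∫⁻ x, ‖timeDerivWithin (Icc 0 T) (vorticity u) t x‖ₑ ^ 2 ≤ 6 * E₁ := by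
    intro t ht
    calc ∫⁻ x, ‖timeDerivWithin (Icc 0 T) (vorticity u) t x‖ₑ ^ 2
        = ∫⁻ x, ‖curl (W t) x‖ₑ ^ 2 := lintegral_congr fun x => by rw [hwt t ht x]
      _ ≤ ∫⁻ x, 6 * ‖iteratedFDeriv ℝ 1 (W t) x‖ₑ ^ 2 := lintegral_mono fun x => hcurl_enorm (W t) x
      _ = 6 * ∫⁻ x, ‖iteratedFDeriv ℝ 1 (W t) x‖ₑ ^ 2 := lintegral_const_mul' _ _ (by norm_num)
      _ ≤ 6 * E₁ := by gcongr; exact hE₁ t ht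
  set Bw : ℝ := ‖(curlCLM : (EuclideanSpace ℝ (Fin 3) →L[ℝ] EuclideanSpace ℝ (Fin 3)) →L[ℝ]
    EuclideanSpace ℝ (Fin 3))‖ * B₁ with hBw
  have hwB : ∀ t ∈ Icc 0 T, ∀ x, ‖vorticity u t x‖ ≤ Bw := fun t ht x =>
    (norm_curl_le (u t) x).trans (mul_le_mul_of_nonneg_left (hB₁ t ht x)
      (norm_nonneg (curlCLM : (EuclideanSpace ℝ (Fin 3) →L[ℝ] EuclideanSpace ℝ (Fin 3)) →L[ℝ]
        EuclideanSpace ℝ (Fin 3))))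
  -- the weighted balance (S2) for `w = vorticity u`
  obtain ⟨hΨint, hΦcont, hΦb⟩ := hS2 hT hwsm (C₀ := 6 * C₁) (C₁ := 6 * E₁) (B := Bw) hw0 hw1 hwB
  -- names for the weighted mass, its production, and the sup norm
  set Φ : ℝ → ℝ := fun t => ∫ x, ((‖vorticity u t x‖ ^ 2 + 1) ^ (5 / 4 : ℝ) - 1) with hΦ
  set Ψ : ℝ → ℝ := fun t => ∫ x, 5 / 2 * ((‖vorticity u t x‖ ^ 2 + 1) ^ (1 / 4 : ℝ) *
    ⟪vorticity u t x, timeDerivWithin (Icc 0 T) (vorticity u) t x⟫) with hΨ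
  have hLtop : ∀ t ∈ Icc 0 T, eLpNorm (u t) ⊤ volume < ⊤ := by
    intro t ht
    rw [eLpNorm_exponent_top]
    exact (eLpNormEssSup_le_of_ae_bound (Eventually.of_forall (hB₀ t ht))).trans_lt
      ENNReal.ofReal_lt_top
  set N : ℝ → ℝ := fun t => (eLpNorm (u t) ⊤ volume).toReal with hN
  have hN0 : ∀ t, 0 ≤ N t := fun t => ENNReal.toReal_nonneg
  have hNpt : ∀ t ∈ Icc 0 T, ∀ x, ‖u t x‖ ≤ N t := fun t ht x =>
    norm_le_toReal_eLpNorm_top_of_continuous (hsol.contDiff_velocity ht).continuous (hLtop t ht) x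
  -- pointwise facts about the weight along the slices
  have hF0 : ∀ t x, 0 ≤ (‖vorticity u t x‖ ^ 2 + 1) ^ (5 / 4 : ℝ) - 1 := fun t x => F_nonneg _
  have hFle : ∀ t ∈ Icc 0 T, ∀ x,
      (‖vorticity u t x‖ ^ 2 + 1) ^ (5 / 4 : ℝ) - 1 ≤ 5 * (Bw ^ 2 + 1) * ‖vorticity u t x‖ ^ 2 :=
    fun t ht x => F_le_mul_sq (hwB t ht x)
  have cvort : ∀ t ∈ Icc 0 T, Continuous (vorticity u t) := fun t ht =>
    (hwsm.contDiff_slice ht).continuous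
  have cF : ∀ t ∈ Icc 0 T, Continuous fun x => (‖vorticity u t x‖ ^ 2 + 1) ^ (5 / 4 : ℝ) - 1 := by
    intro t ht
    refine (Continuous.rpow_const ?_ fun x => Or.inr (by norm_num)).sub continuous_const
    exact ((cvort t ht).norm.pow 2).add continuous_const
  have cwt : ∀ t ∈ Icc 0 T, Continuous fun x => (‖vorticity u t x‖ ^ 2 + 1) ^ (1 / 4 : ℝ) := by
    intro t ht
    refine Continuous.rpow_const ?_ fun x => Or.inr (by norm_num)
    exact ((cvort t ht).norm.pow 2).add continuous_const
  have hvort_lt : ∀ t ∈ Icc 0 T, ∫⁻ x, ‖vorticity u t x‖ₑ ^ 2 < ⊤ := fun t ht =>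
    (hw0 t ht).trans_lt (ENNReal.mul_lt_top (by norm_num) ENNReal.coe_lt_top)
  have isq : ∀ t ∈ Icc 0 T, Integrable (fun x => ‖vorticity u t x‖ ^ 2) volume := fun t ht =>
    integrable_sq_norm_of_lintegral_lt_top (cvort t ht) (hvort_lt t ht)
  have iF : ∀ t ∈ Icc 0 T,
      Integrable (fun x => (‖vorticity u t x‖ ^ 2 + 1) ^ (5 / 4 : ℝ) - 1) volume := by
    intro t ht
    refine Integrable.mono' ((isq t ht).const_mul (5 * (Bw ^ 2 + 1))) (cF t ht).aestronglyMeasurable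
      (Eventually.of_forall fun x => ?_)
    rw [Real.norm_of_nonneg (hF0 t x)]
    exact hFle t ht x
  have iwsq : ∀ t ∈ Icc 0 T, Integrable
      (fun x => (‖vorticity u t x‖ ^ 2 + 1) ^ (1 / 4 : ℝ) * ‖vorticity u t x‖ ^ 2) volume := by
    intro t ht
    refine Integrable.mono' (iF t ht) ((cwt t ht).mul ((cvort t ht).norm.pow 2)).aestronglyMeasurable
      (Eventually.of_forall fun x => ?_)
    rw [Real.norm_of_nonneg (mul_nonneg (Real.rpow_nonneg (by positivity) _) (sq_nonneg _))]
    exact weight_mul_sq_le_F _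
  have hΦ0 : ∀ t, 0 ≤ Φ t := fun t => integral_nonneg fun x => hF0 t x
  have hΦeq : ∀ t ∈ Icc 0 T, ENNReal.ofReal (Φ t) =
      ∫⁻ x, ENNReal.ofReal ((‖curl (u t) x‖ ^ 2 + 1) ^ (5 / 4 : ℝ) - 1) := fun t ht =>
    ofReal_integral_eq_lintegral_ofReal (iF t ht) (Eventually.of_forall fun x => hF0 t x)
  -- THE SLICE BOUND at interior times: `Ψ t ≤ (5c/(2ν)) N(t)² Φ t`
  set Nq : ℝ → ℝ := fun t => N t ^ (2 : ℝ) with hNq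
  have hNq0 : ∀ t, 0 ≤ Nq t := fun t => Real.rpow_nonneg (hN0 t) _
  have hslice : ∀ t ∈ Ioo 0 T, Ψ t ≤ 5 * c / (2 * ν) * Nq t * Φ t := by
    intro t ht
    have htI : t ∈ Icc 0 T := Ioo_subset_Icc_self ht
    have hZ : ∀ x, curl (W t) x = ν • (Δ (curl (u t))) x - convect (u t) (curl (u t)) x +
        convect (curl (u t)) (u t) x := by
      intro x
      have h := hsol.curl_timeDerivWithin_eq hU htI x
      rw [show ((0 : ℝ → EuclideanSpace ℝ (Fin 3) → EuclideanSpace ℝ (Fin 3)) t) = 0 from rfl,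
        curl_zero, add_zero] at h
      exact h
    have h1 : ∫⁻ x, ‖iteratedFDeriv ℝ 1 (u t) x‖ₑ ^ 2 < ⊤ := (hC₁ t htI).trans_lt ENNReal.coe_lt_top
    have h2 : ∫⁻ x, ‖iteratedFDeriv ℝ 2 (u t) x‖ₑ ^ 2 < ⊤ := (hC₂ t htI).trans_lt ENNReal.coe_lt_top
    have h3 : ∫⁻ x, ‖iteratedFDeriv ℝ 3 (u t) x‖ₑ ^ 2 < ⊤ := (hC₃ t htI).trans_lt ENNReal.coe_lt_top
    have h4 : ∫⁻ x, ‖iteratedFDeriv ℝ 1 (W t) x‖ₑ ^ 2 < ⊤ := (hE₁ t htI).trans_lt ENNReal.coe_lt_top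
    have hdep := hlaw (u t) (N t) B₁ ((hsol.contDiff_velocity htI).of_le (by norm_cast))
      (hsol.divFree t htI) (hNpt t htI) (hB₁ t htI) h1 h2
    have hsl := depletedSlice_curl hν hc (hsol.contDiff_velocity htI) (hsol.divFree t htI) hZ
      (hNpt t htI) (hB₁ t htI) h1 h2 h3 hdep
    -- rewrite `Ψ t` in terms of `curl (W t)`
    have hΨt : Ψ t = 5 / 2 * ∫ x, (‖curl (u t) x‖ ^ 2 + 1) ^ (1 / 4 : ℝ) *
        ⟪curl (u t) x, curl (W t) x⟫ := by
      rw [hΨ]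
      simp only
      rw [← integral_const_mul]
      refine integral_congr_ae (Eventually.of_forall fun x => ?_)
      simp only [vorticity_apply, hwt t htI x]
    -- bound the right-hand side of the slice inequality by `N(t)² Φ t`
    have hrhs : (N t) ^ 2 * ∫ x, (‖curl (u t) x‖ ^ 2 + 1) ^ (1 / 4 : ℝ) * ‖curl (u t) x‖ ^ 2 ≤
        Nq t * Φ t := by
      have hNN : (N t) ^ 2 = Nq t := by rw [hNq]; simp only [Real.rpow_two]
      rw [hNN]
      refine mul_le_mul_of_nonneg_left ?_ (hNq0 t)
      have hint : Integrable (fun x => ((‖curl (u t) x‖ ^ 2 + 1) ^ (5 / 4 : ℝ) - 1)) volume :=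
        iF t htI
      exact integral_mono (iwsq t htI) hint fun x => weight_mul_sq_le_F _
    have hν' : 0 ≤ c / ν := by positivity
    calc Ψ t = 5 / 2 * ∫ x, (‖curl (u t) x‖ ^ 2 + 1) ^ (1 / 4 : ℝ) *
          ⟪curl (u t) x, curl (W t) x⟫ := hΨt
      _ ≤ 5 / 2 * (c / ν * (Nq t * Φ t)) := by
          refine mul_le_mul_of_nonneg_left (hsl.trans ?_) (by norm_num)
          exact mul_le_mul_of_nonneg_left hrhs hν'
      _ = 5 * c / (2 * ν) * Nq t * Φ t := by ring
  -- Grönwall in `ℝ≥0∞`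
  set φE : ℝ → ℝ≥0∞ := fun t => ENNReal.ofReal (Φ t) with hφE
  set kc : ℝ := 5 * c / (2 * ν) with hkc
  have hκ0 : 0 ≤ kc := by positivity
  set aE : ℝ → ℝ≥0∞ := fun t => ENNReal.ofReal kc * ENNReal.ofReal (Nq t) with haE
  -- a uniform bound for `Φ` on `[0, T]` from its continuity on the compact slab
  obtain ⟨Mb, hMb⟩ : ∃ Mb : ℝ, ∀ t ∈ Icc 0 T, Φ t ≤ Mb := by
    obtain ⟨Mb, hMb⟩ := isCompact_Icc.exists_bound_of_continuousOn hΦcont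
    exact ⟨Mb, fun t ht => (le_abs_self _).trans ((Real.norm_eq_abs _).symm.le.trans (hMb t ht))⟩
  have hM : ∀ t ∈ Icc 0 s, φE t ≤ ENNReal.ofReal Mb := fun t ht =>
    ENNReal.ofReal_le_ofReal (hMb t ⟨ht.1, ht.2.trans hs.2⟩)
  have haS : ∫⁻ t in Ioo 0 s, aE t ≠ ⊤ := by
    rw [haE]; simp only
    rw [lintegral_const_mul' _ _ ENNReal.ofReal_ne_top]
    exact ENNReal.mul_ne_top ENNReal.ofReal_ne_top hA
  have hineq : ∀ t ∈ Icc 0 s, φE t ≤ φE 0 + ∫⁻ τ in Ioo 0 t, aE τ * φE τ := by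
    intro t ht
    rcases eq_or_lt_of_le ht.1 with h0 | ht0
    · rw [← h0]; simp
    have htT : t ∈ Ioc 0 T := ⟨ht0, ht.2.trans hs.2⟩
    have hΨt : IntegrableOn Ψ (Ioo 0 t) volume := hΨint.mono_set (Ioo_subset_Ioo le_rfl htT.2)
    have h1 : ENNReal.ofReal (∫ τ in Ioo 0 t, Ψ τ) ≤ ∫⁻ τ in Ioo 0 t, ENNReal.ofReal (Ψ τ) := by
      calc ENNReal.ofReal (∫ τ in Ioo 0 t, Ψ τ) ≤ ENNReal.ofReal (∫ τ in Ioo 0 t, max (Ψ τ) 0) :=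
            ENNReal.ofReal_le_ofReal (integral_mono hΨt hΨt.pos_part fun τ => le_max_left _ _)
        _ = ∫⁻ τ in Ioo 0 t, ENNReal.ofReal (max (Ψ τ) 0) :=
            ofReal_integral_eq_lintegral_ofReal hΨt.pos_part
              (Eventually.of_forall fun τ => le_max_right _ _)
        _ = ∫⁻ τ in Ioo 0 t, ENNReal.ofReal (Ψ τ) := lintegral_congr fun τ => by
            rcases le_total (Ψ τ) 0 with h | h
            · rw [max_eq_right h, ENNReal.ofReal_zero, ENNReal.ofReal_of_nonpos h]
            · rw [max_eq_left h]
    have h2 : ∫⁻ τ in Ioo 0 t, ENNReal.ofReal (Ψ τ) ≤ ∫⁻ τ in Ioo 0 t, aE τ * φE τ := by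
      refine setLIntegral_mono' measurableSet_Ioo fun τ hτ => ?_
      have hτT : τ ∈ Ioo 0 T := ⟨hτ.1, hτ.2.trans_le htT.2⟩
      calc ENNReal.ofReal (Ψ τ) ≤ ENNReal.ofReal (kc * Nq τ * Φ τ) :=
            ENNReal.ofReal_le_ofReal (by simpa [hkc, mul_assoc] using hslice τ hτT)
        _ = aE τ * φE τ := by
            rw [haE, hφE]; simp only
            rw [ENNReal.ofReal_mul (mul_nonneg hκ0 (hNq0 τ)), ENNReal.ofReal_mul hκ0]
    calc φE t = ENNReal.ofReal (Φ 0 + ∫ τ in (0 : ℝ)..t, Ψ τ) := by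
          rw [hφE]; simp only; congr 1; exact hΦb t htT
      _ ≤ ENNReal.ofReal (Φ 0) + ENNReal.ofReal (∫ τ in (0 : ℝ)..t, Ψ τ) := ENNReal.ofReal_add_le
      _ = φE 0 + ENNReal.ofReal (∫ τ in Ioo 0 t, Ψ τ) := by
          rw [intervalIntegral.integral_of_le ht.1, integral_Ioc_eq_integral_Ioo]
      _ ≤ φE 0 + ∫⁻ τ in Ioo 0 t, aE τ * φE τ := by gcongr; exact h1.trans h2
  have hgron := lintegral_gronwall_le (S := s) ENNReal.ofReal_ne_top ENNReal.ofReal_ne_top hM haS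
    hineq s ⟨hs.1.le, le_rfl⟩
  -- unpack
  have hint_a : (∫⁻ τ in Ioo 0 s, aE τ).toReal =
      kc * (∫⁻ t in Ioo 0 s, ENNReal.ofReal (Nq t)).toReal := by
    rw [haE]; simp only
    rw [lintegral_const_mul' _ _ ENNReal.ofReal_ne_top, ENNReal.toReal_mul, ENNReal.toReal_ofReal hκ0]
  rw [hint_a] at hgron
  rw [← hΦeq s ⟨hs.1.le, hs.2⟩, ← hΦeq 0 ⟨le_rfl, hT.le⟩, mul_comm]
  convert hgron using 3

end Summit.NavierStokesRegularity.NavierStokesRegularity.Theorems.FiveHalvesWindow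

end
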